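import Literature.ComputerArithmetic.Higham2002.Summation

/-!
# FABsum — fast and accurate blocked summation: the backward error of a two-level (blocked) sum,
`ε(n, b) = ε_f(b) + ε_a(n/b) + ε_f(b)·ε_a(n/b)` (Blanchard–Higham–Mary 2020)

HONEST FRAMING (ENGINES group, unit `eng-quad-4`, kernels lane of the `certquad` engine — shared
numerical engines serving client cells; rigour lives in the verifiers; every published number
belongs to a client cell's ledger, not to the engines group): the engine's estimators ACCUMULATE
their samples exactly the way this paper analyses — a FAST sum inside each block of evaluations
(one worker, one lattice block) and a more ACCURATE combination of the block sums (extended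
precision / exact summation). The kernels' trust bound covers the evaluation of ONE integrand value
and says nothing about the accumulation; this file types and PROVES the published backward error
analysis of such two-level sums in MODEL form (the rounding errors are HYPOTHESES over an ordered
field `K` with unit roundoff `u`, exactly as in `Higham2002/Summation.lean`, which this file extends
with the BACKWARD reading of recursive summation). No hardware, vendor, timing or flop-count claims.

Source read at the page: [BlanchardHighamMary2020] = P. Blanchard, N. J. Higham, T. Mary, *A class
of fast and accurate summation algorithms*, SIAM J. Sci. Comput. 42(3) (2020) A1541–A1557,
doi 10.1137/19M1257780 (CC-BY), read in the held text `paper:doi-10-1137-19m1257780` (12 chunks):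
§2 (the standard model (2.1); §2.1 recursive summation (2.2); §2.2 blocked summation (2.3)–(2.4)
"`b + n/b − 2`"; §2.3 pairwise summation (2.5); §2.4 compensated summation (2.6)–(2.7) = Algorithm
2.1 with the bound of [Goldberg 1991, Thm. 8]); §3 (Algorithm 3.1 `FABsum`; §3.1 the hypotheses
(3.1) on `FastSum` and (3.2) on `AccurateSum`, THEOREM 3.1 with its proof (3.3)–(3.4), the three
instances (3.5)–(3.7): `AccurateSum` = recursive summation in doubled precision with a final
rounding / compensated summation / pairwise summation; §3.1.1 accuracy versus stability = the
Oettli–Prager backward error of a sum and the condition number; §3.1.2 second-order contributions;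
§3.2 cost); §4 (Algorithm 4.1 inner product via FABsum, THEOREM 4.1, THEOREM 4.2 (matrix–vector and
matrix–matrix products), Lemma 4.3, Theorems 4.4–4.6 (triangular systems, LU)); §6 conclusion
("backward error bound `(b + 1)u + O(u²)`"). TEXT-LAYER CAVEAT (recorded, not hidden): the held
text layer of this paper carries the prose, the equation NUMBERS and the proofs but not the
displayed formulas; every statement below is fixed by the proofs' own words (THEOREM 3.1: "Combining
(3.3) and (3.4) and defining `μᵃᵢ = μᵃ_{⌈i/b⌉}` … the result follows"; §3.1.2: "the second order
terms of FABsum can be obtained by adding the second order terms of `ε_f(b)` and `ε_a(n/b)` to the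
product of their first order terms"; §2.2: "the constant `b + n/b − 2` in the bound"; §6) and was
cross-checked against the restatement of (2.2), (2.7), (3.1)–(3.2) and of the FABsum / FABdot
constants `(b+1)u + O(u²)` / `(b+2)u + O(u²)` in He–Barrio–Chen–Liu, *A class of fast and accurate
multi-layer block summation and dot product algorithms*, NPC 2021, LNCS 13152 (§2), and against
Higham–Mary, SIAM J. Sci. Comput. 42 (2020) A3427, §4.3 ("FABsum … error bounded by `bu`"). Every
declaration is PROVED; nothing enters as a named fact, so the caveat bears on attribution only.

INDEXING. As in `Higham2002/Summation.lean` we index by the NUMBER OF ADDITIONS: a block holds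
`b + 1` summands `x c 0, …, x c b` (the source's block size `b` is our `b + 1`), there are `m + 1`
blocks (the source's `n/b` is our `m + 1`), so the source's `γ_{b−1}`, `γ_{n/b−1}` and
`b + n/b − 2` read `γ_b`, `γ_m` and `b + m` here. The source assumes `b ∣ n`; THEOREM 3.1 is typed
below for blocks of ARBITRARY (dependent) index sets, which costs nothing in the proof and is the
case the engine meets.

CONTENT (all typed and PROVED over a `LinearOrderedField` `K`; `u ≥ 0` where needed):
* `IsBackwardSum s x ŝ ε` — eqs. (3.1)/(3.2): `ŝ = Σ_{i∈s} xᵢ(1 + μᵢ)` with `|μᵢ| ≤ ε`;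
  `abs_sub_sum_le_of_isBackwardSum` (forward ≤ `ε Σ|xᵢ|`), `IsBackwardSum.mono`, `.of_eq`;
* `abs_one_add_mul_one_add_sub_one_le` — the one-line engine of THEOREM 3.1:
  `|(1 + a)(1 + b) − 1| ≤ (1 + A)(1 + B) − 1 = A + B + AB`;
* `theorem31` — THEOREM 3.1 for blocks `c ∈ t` with position sets `sk c` (dependent), local sums
  `ŝ c` backward-exact to `εf`, total `T` backward-exact (w.r.t. the `ŝ c`) to `εa` ⟹ `T` is
  backward-exact w.r.t. the data to `εf + εa + εf·εa`; `theorem31_fintype` (uniform blocks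
  `Fin`-style, the printed shape); `theorem31_isBackwardSum` (the `Σ`-type packaging);
* `recFactor`, `recSum_eq_sum_mul_recFactor` — the BACKWARD READING of recursive summation
  ([Higham2002ASNA (4.2)] unrolled): `ŝₙ = Σ_{i≤n} xᵢ ∏_{k=max(i,1)}^{n} (1 + δₖ)`;
  `abs_prod_one_add_sub_one_le` (`|∏_{k∈s}(1 + δₖ) − 1| ≤ (1 + u)^{#s} − 1`);
  `recSum_backward(_gamma)` — eq. (2.2): `|μᵢ| ≤ (1 + u)ⁿ − 1 ≤ γₙ`;
* `blockedRecSum`, `blockedRecSum_backward(_gamma)` — eq. (2.4): blocked recursive summation,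
  `|μ| ≤ (1 + u)^{b+m} − 1 ≤ γ_{b+m}` (the source's `γ_{b+n/b−2}`);
* `fabsum_recursive_backward` — THEOREM 3.1 with `FastSum` = recursive summation and ANY
  `AccurateSum` of backward constant `εa`: `|μ| ≤ (1 + u)ᵇ(1 + εa) − 1`; its three instances
  `fabsum_doubled_backward` — (3.5): `AccurateSum` = recursive summation with unit roundoff `u²`
  and a final rounding to `u`, CONCRETELY: `|μ| ≤ (1 + u)ᵇ(1 + u²)ᵐ(1 + u) − 1`;
  `fabsum_compensated_backward` — (3.6): `AccurateSum` of constant `εa` (compensated summation,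
  `εa = 2u + O(u²)` by (2.7) = [Goldberg 1991, Thm. 8], taken as the hypothesis it is in the
  source); `fabsum_pairwise_backward(_gamma)` — (3.7): `AccurateSum` of constant `(1 + u)ᴸ − 1`
  (pairwise summation, `L = ⌈log₂(n/b)⌉` by (2.5)): `|μ| ≤ (1 + u)^{b+L} − 1 ≤ γ_{b+L}`;
* `one_add_pow_sub_one_le_mul_pow` — the first-order readings of §3.1.2 made rigorous once and for
  all: `(1 + u)ᵏ − 1 ≤ k·u·(1 + u)^{k−1}` (so every product-form constant above is its printed
  first-order term times a factor `1 + O(u)`);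
* `backwardError`, `backwardError_le_of_isBackwardSum`, `isBackwardSum_backwardError`,
  `condSum`, `abs_sub_sum_div_le` — §3.1.1: `η(ŝ) = |ŝ − s| / Σ|xᵢ|` IS the smallest backward
  error (Oettli–Prager for sums, [Higham2002ASNA, Thm. 7.3]) and the relative forward error is
  at most `cond · ε`, `cond = Σ|xᵢ| / |s|`;
* `theorem41` — THEOREM 4.1: inner product via FABsum, `|μ| ≤ (1 + u)(1 + ε) − 1 = u + ε + uε`;
  `theorem42_mulVec` — THEOREM 4.2 (matrix–vector): `ŷ = (A + ΔA)x`, `|ΔA| ≤ ε|A|`;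
  `theorem42_mul` — THEOREM 4.2 (matrix–matrix): `|Ĉ − AB| ≤ ε|A||B|` componentwise.

NOT formalised here: Lemma 4.3 and Theorems 4.4–4.6 (substitution and LU with FABsum inner
products — their constants are not recoverable from the held text layer, see the caveat); the cost
analysis §3.2 and the experiments §5; the bounds (2.5) (pairwise, [Higham2002ASNA §4.2], cf.
`HallmanIpsen2023.CompTree.pairwise_abs_err_le`) and (2.7) (compensated summation, [Goldberg
1991, Thm. 8]) themselves, which enter (3.6)/(3.7) as the hypotheses they are in the source; the
`O(u²)` expansions of §3.1.2 (replaced by the exact product forms, which imply them).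
-/

namespace Literature.ComputerArithmetic.BlanchardHighamMary2020

open Finset Literature.ComputerArithmetic.Higham2002

variable {K : Type*} [Field K] [LinearOrder K] [IsStrictOrderedRing K]

/-! ## §3.1, eqs. (3.1)–(3.2): the backward-error form of a computed sum -/

/-- `IsBackwardSum s x ŝ ε`: the computed value `ŝ` of the sum `Σ_{i ∈ s} xᵢ` has a BACKWARD ERROR
at most `ε`, i.e. `ŝ = Σ_{i ∈ s} xᵢ (1 + μᵢ)` for some perturbations `|μᵢ| ≤ ε` (`i ∈ s`). This is the
shape of hypothesis (3.1) on `FastSum` (`ε = ε_f(n)`), of hypothesis (3.2) on `AccurateSum`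
(`ε = ε_a(n)`), and of the conclusion of Theorem 3.1.
[cite: BlanchardHighamMary2020, §3.1 eqs. (3.1)–(3.2)] -/
def IsBackwardSum {ι : Type*} (s : Finset ι) (x : ι → K) (ŝ ε : K) : Prop :=
  ∃ μ : ι → K, (∀ i ∈ s, |μ i| ≤ ε) ∧ ŝ = ∑ i ∈ s, x i * (1 + μ i)

omit [IsStrictOrderedRing K] in
/-- A backward error bound may be weakened. [cite: BlanchardHighamMary2020, §3.1 eqs. (3.1)–(3.2)] -/
theorem IsBackwardSum.mono {ι : Type*} {s : Finset ι} {x : ι → K} {ŝ ε ε' : K}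
    (h : IsBackwardSum s x ŝ ε) (hε : ε ≤ ε') : IsBackwardSum s x ŝ ε' := by
  obtain ⟨μ, hμ, hs⟩ := h
  exact ⟨μ, fun i hi => le_trans (hμ i hi) hε, hs⟩

/-- The exact sum has backward error `0`. [cite: BlanchardHighamMary2020, §3.1 eqs. (3.1)–(3.2)] -/
theorem isBackwardSum_sum {ι : Type*} (s : Finset ι) (x : ι → K) :
    IsBackwardSum s x (∑ i ∈ s, x i) 0 :=
  ⟨fun _ => 0, fun _ _ => by simp, by simp⟩

/-- FORWARD from BACKWARD: `ŝ = Σ xᵢ(1 + μᵢ)`, `|μᵢ| ≤ ε` gives `|ŝ − Σ xᵢ| ≤ ε · Σ |xᵢ|` (the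
numerator of the Oettli–Prager quotient of §3.1.1).
[cite: BlanchardHighamMary2020, §3.1.1] -/
theorem abs_sub_sum_le_of_isBackwardSum {ι : Type*} {s : Finset ι} {x : ι → K} {ŝ ε : K}
    (h : IsBackwardSum s x ŝ ε) : |ŝ - ∑ i ∈ s, x i| ≤ ε * ∑ i ∈ s, |x i| := by
  obtain ⟨μ, hμ, hs⟩ := h
  have hrew : ŝ - ∑ i ∈ s, x i = ∑ i ∈ s, x i * μ i := by
    rw [hs, ← Finset.sum_sub_distrib]
    refine Finset.sum_congr rfl fun i _ => by ring
  rw [hrew, Finset.mul_sum]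
  refine le_trans (Finset.abs_sum_le_sum_abs _ _) (Finset.sum_le_sum fun i hi => ?_)
  rw [abs_mul, mul_comm]
  exact mul_le_mul_of_nonneg_right (hμ i hi) (abs_nonneg _)

/-! ## The engine of Theorem 3.1: composing two relative perturbations -/

/-- `|(1 + a)(1 + b) − 1| ≤ (1 + A)(1 + B) − 1` (`= A + B + AB`) whenever `|a| ≤ A`, `|b| ≤ B`: the
local perturbation `μᶠ` and the block perturbation `μᵃ` compose to `μ = μᶠ + μᵃ + μᶠμᵃ`.
[cite: BlanchardHighamMary2020, §3.1 proof of Theorem 3.1] -/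
theorem abs_one_add_mul_one_add_sub_one_le {a b A B : K} (ha : |a| ≤ A) (hb : |b| ≤ B) :
    |(1 + a) * (1 + b) - 1| ≤ (1 + A) * (1 + B) - 1 := by
  have hA : 0 ≤ A := le_trans (abs_nonneg a) ha
  have h1 : (1 + a) * (1 + b) - 1 = a + (b + a * b) := by ring
  rw [h1]
  calc |a + (b + a * b)| ≤ |a| + |b + a * b| := abs_add_le _ _
    _ ≤ |a| + (|b| + |a * b|) := by linarith [abs_add_le b (a * b)]
    _ = |a| + (|b| + |a| * |b|) := by rw [abs_mul]
    _ ≤ A + (B + A * B) := by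
        have := mul_le_mul ha hb (abs_nonneg b) hA
        linarith
    _ = (1 + A) * (1 + B) - 1 := by ring

omit [LinearOrder K] [IsStrictOrderedRing K] in
/-- The constant of Theorem 3.1 in its two spellings: `(1 + εf)(1 + εa) − 1 = εf + εa + εf·εa`.
[cite: BlanchardHighamMary2020, §3.1 Theorem 3.1] -/
theorem one_add_mul_one_add_sub_one (εf εa : K) :
    (1 + εf) * (1 + εa) - 1 = εf + εa + εf * εa := by ring

/-! ## THEOREM 3.1 — the backward error of FABsum (Algorithm 3.1) -/

/-- THEOREM 3.1 (FABsum, Algorithm 3.1), typed for blocks `c ∈ t` with ARBITRARY position sets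
`sk c`: if every local sum is backward-exact to `εf` — `ŝ c = Σ_{j ∈ sk c} x c j (1 + μᶠ c j)`,
`|μᶠ c j| ≤ εf` (hypothesis (3.1) on `FastSum`, eq. (3.3)) — and the total is backward-exact to `εa`
with respect to the computed local sums — `T = Σ_{c ∈ t} ŝ c (1 + μᵃ c)`, `|μᵃ c| ≤ εa` (hypothesis
(3.2) on `AccurateSum`, eq. (3.4)) — then `T = Σ_c Σ_j x c j (1 + μ c j)` with
`|μ c j| ≤ ε(n, b) = εf + εa + εf·εa` (`μ c j = μᶠ c j + μᵃ c + μᶠ c j · μᵃ c`).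
[cite: BlanchardHighamMary2020, §3.1 Theorem 3.1] -/
theorem theorem31 {β κ : Type*} (t : Finset β) (sk : β → Finset κ) (x : β → κ → K) (ŝ : β → K)
    {εf εa T : K}
    (hloc : ∀ c ∈ t, ∃ μ : κ → K, (∀ j ∈ sk c, |μ j| ≤ εf) ∧ ŝ c = ∑ j ∈ sk c, x c j * (1 + μ j))
    (htot : ∃ μ : β → K, (∀ c ∈ t, |μ c| ≤ εa) ∧ T = ∑ c ∈ t, ŝ c * (1 + μ c)) :
    ∃ μ : β → κ → K, (∀ c ∈ t, ∀ j ∈ sk c, |μ c j| ≤ εf + εa + εf * εa) ∧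
      T = ∑ c ∈ t, ∑ j ∈ sk c, x c j * (1 + μ c j) := by
  classical
  -- choose the local perturbations block by block (outside `t` anything will do)
  have hch : ∀ c, ∃ μ : κ → K, c ∈ t → (∀ j ∈ sk c, |μ j| ≤ εf) ∧
      ŝ c = ∑ j ∈ sk c, x c j * (1 + μ j) := by
    intro c
    by_cases hc : c ∈ t
    · obtain ⟨μ, hμ⟩ := hloc c hc
      exact ⟨μ, fun _ => hμ⟩
    · exact ⟨fun _ => 0, fun h => absurd h hc⟩
  choose μf hμf using hch
  obtain ⟨μa, hμa, hT⟩ := htot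
  refine ⟨fun c j => (1 + μf c j) * (1 + μa c) - 1, ?_, ?_⟩
  · intro c hc j hj
    rw [← one_add_mul_one_add_sub_one]
    exact abs_one_add_mul_one_add_sub_one_le ((hμf c hc).1 j hj) (hμa c hc)
  · rw [hT]
    refine Finset.sum_congr rfl fun c hc => ?_
    rw [(hμf c hc).2, Finset.sum_mul]
    refine Finset.sum_congr rfl fun j _ => by ring

/-- THEOREM 3.1 in the `IsBackwardSum` packaging over the disjoint union of the blocks
(`Finset.sigma`): local sums backward-exact to `εf`, their combination backward-exact to `εa` ⟹ the
total is backward-exact to `εf + εa + εf·εa` with respect to all `n` summands.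
[cite: BlanchardHighamMary2020, §3.1 Theorem 3.1] -/
theorem theorem31_isBackwardSum {β κ : Type*} (t : Finset β) (sk : β → Finset κ) (x : β → κ → K)
    (ŝ : β → K) {εf εa T : K}
    (hloc : ∀ c ∈ t, IsBackwardSum (sk c) (x c) (ŝ c) εf) (htot : IsBackwardSum t ŝ T εa) :
    IsBackwardSum (t.sigma sk) (fun p => x p.1 p.2) T (εf + εa + εf * εa) := by
  obtain ⟨μ, hμ, hT⟩ := theorem31 t sk x ŝ hloc htot
  refine ⟨fun p => μ p.1 p.2, fun p hp => ?_, ?_⟩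
  · rw [Finset.mem_sigma] at hp
    exact hμ p.1 hp.1 p.2 hp.2
  · rw [hT, Finset.sum_sigma]

/-- THEOREM 3.1 in the printed shape: `n/b` blocks (index type `α`) of `b` summands each (index
type `κ`), all local sums computed by `FastSum` (backward constant `εf = ε_f(b)`), the local sums
summed by `AccurateSum` (backward constant `εa = ε_a(n/b)`): the computed `ŝ` satisfies
`ŝ = Σᵢ xᵢ(1 + μᵢ)`, `|μᵢ| ≤ ε(n, b) = ε_f(b) + ε_a(n/b) + ε_f(b) ε_a(n/b)`.
[cite: BlanchardHighamMary2020, §3.1 Theorem 3.1] -/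
theorem theorem31_fintype {α κ : Type*} [Fintype α] [Fintype κ] (x : α → κ → K) (ŝ : α → K)
    {εf εa T : K}
    (hloc : ∀ c, ∃ μ : κ → K, (∀ j, |μ j| ≤ εf) ∧ ŝ c = ∑ j, x c j * (1 + μ j))
    (htot : ∃ μ : α → K, (∀ c, |μ c| ≤ εa) ∧ T = ∑ c, ŝ c * (1 + μ c)) :
    ∃ μ : α → κ → K, (∀ c j, |μ c j| ≤ εf + εa + εf * εa) ∧
      T = ∑ c, ∑ j, x c j * (1 + μ c j) := by
  obtain ⟨μ, hμ, hT⟩ := theorem31 (Finset.univ : Finset α) (fun _ => (Finset.univ : Finset κ)) x ŝ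
    (εf := εf) (εa := εa) (T := T)
    (fun c _ => by
      obtain ⟨μ, hμ, hs⟩ := hloc c
      exact ⟨μ, fun j _ => hμ j, hs⟩)
    (by
      obtain ⟨μ, hμ, hs⟩ := htot
      exact ⟨μ, fun c _ => hμ c, hs⟩)
  exact ⟨μ, fun c j => hμ c (Finset.mem_univ c) j (Finset.mem_univ j), hT⟩

/-! ## §2.1, eq. (2.2): the backward reading of recursive summation

`Higham2002.recSum x δ n` is recursive summation of `x 0, …, x n` in the model
(`ŝ₀ = x₀`, `ŝₖ₊₁ = (ŝₖ + xₖ₊₁)(1 + δₖ₊₁)`); unrolled, summand `i` is multiplied by every factor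
`1 + δₖ` with `max(i,1) ≤ k ≤ n`. -/

/-- The product of the rounding factors met by summand `i` in recursive summation up to step `n`:
`∏_{k = max(i,1)}^{n} (1 + δₖ)`. [cite: BlanchardHighamMary2020, §2.1 eq. (2.2)] -/
def recFactor (δ : ℕ → K) (i n : ℕ) : K := ∏ k ∈ Finset.Icc (max i 1) n, (1 + δ k)

omit [LinearOrder K] [IsStrictOrderedRing K] in
/-- `recFactor δ i 0 = 1` (no addition performed yet). [cite: BlanchardHighamMary2020, §2.1 eq. (2.2)] -/
theorem recFactor_zero (δ : ℕ → K) (i : ℕ) : recFactor δ i 0 = 1 := by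
  unfold recFactor
  have h : Finset.Icc (max i 1) 0 = ∅ := by
    ext k
    simp only [Finset.mem_Icc, Finset.notMem_empty, iff_false, not_and, not_le]
    intro hk
    exact lt_of_lt_of_le Nat.zero_lt_one (le_trans (le_max_right i 1) hk)
  rw [h, Finset.prod_empty]

omit [LinearOrder K] [IsStrictOrderedRing K] in
/-- One more addition multiplies the factor of every earlier summand by `1 + δₙ₊₁`.
[cite: BlanchardHighamMary2020, §2.1 eq. (2.2)] -/
theorem recFactor_succ (δ : ℕ → K) {i n : ℕ} (hi : i ≤ n + 1) :
    recFactor δ i (n + 1) = recFactor δ i n * (1 + δ (n + 1)) := by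
  unfold recFactor
  have hle : max i 1 ≤ n + 1 := max_le hi (Nat.succ_le_succ (Nat.zero_le n))
  rw [Finset.prod_Icc_succ_top hle]

omit [LinearOrder K] [IsStrictOrderedRing K] in
/-- The new summand `xₙ₊₁` meets exactly the factor `1 + δₙ₊₁`.
[cite: BlanchardHighamMary2020, §2.1 eq. (2.2)] -/
theorem recFactor_self_succ (δ : ℕ → K) (n : ℕ) : recFactor δ (n + 1) (n + 1) = 1 + δ (n + 1) := by
  rw [recFactor_succ δ le_rfl, recFactor]
  have h : Finset.Icc (max (n + 1) 1) n = ∅ := by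
    ext k
    simp only [Finset.mem_Icc, Finset.notMem_empty, iff_false, not_and, not_le]
    intro hk
    exact lt_of_lt_of_le (Nat.lt_succ_self n) (le_trans (le_max_left (n + 1) 1) hk)
  rw [h, Finset.prod_empty, one_mul]

omit [LinearOrder K] [IsStrictOrderedRing K] in
/-- RECURSIVE SUMMATION UNROLLED (the backward reading of [Higham2002ASNA (4.2)]):
`ŝₙ = Σ_{i ≤ n} xᵢ · ∏_{k = max(i,1)}^{n} (1 + δₖ)`.
[cite: BlanchardHighamMary2020, §2.1 eq. (2.2)] -/
theorem recSum_eq_sum_mul_recFactor (x δ : ℕ → K) :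
    ∀ n : ℕ, recSum x δ n = ∑ i ∈ range (n + 1), x i * recFactor δ i n
  | 0 => by simp [recSum, recFactor_zero]
  | n + 1 => by
      rw [recSum, recSum_eq_sum_mul_recFactor x δ n, Finset.sum_range_succ _ (n + 1),
        recFactor_self_succ, add_mul, Finset.sum_mul]
      congr 1
      refine Finset.sum_congr rfl fun i hi => ?_
      rw [recFactor_succ δ (le_trans (Nat.le_of_lt_succ (Finset.mem_range.mp hi)) (Nat.le_succ n))]
      ring

/-- `|∏_{k ∈ s} (1 + δₖ) − 1| ≤ (1 + u)^{#s} − 1` for `|δₖ| ≤ u`, `u ≥ 0` (the product form of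
[Higham2002ASNA, Lemma 3.1], no `nu < 1` needed). [cite: BlanchardHighamMary2020, §2.1 eq. (2.2)] -/
theorem abs_prod_one_add_sub_one_le {u : K} (hu : 0 ≤ u) (δ : ℕ → K) (hδ : ∀ k, |δ k| ≤ u) :
    ∀ s : Finset ℕ, |∏ k ∈ s, (1 + δ k) - 1| ≤ (1 + u) ^ s.card - 1 := by
  classical
  intro s
  induction s using Finset.induction_on with
  | empty => simp
  | insert a s ha ih =>
      rw [Finset.prod_insert ha, Finset.card_insert_of_notMem ha, pow_succ, mul_comm ((1 + u) ^ _)]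
      have hP : |∏ k ∈ s, (1 + δ k)| ≤ (1 + u) ^ s.card := by
        have := abs_sub_abs_le_abs_sub (∏ k ∈ s, (1 + δ k)) 1
        rw [abs_one] at this
        linarith
      have hd := hδ a
      have h1 : (1 + δ a) * ∏ k ∈ s, (1 + δ k) - 1
          = δ a * ∏ k ∈ s, (1 + δ k) + (∏ k ∈ s, (1 + δ k) - 1) := by ring
      rw [h1]
      calc |δ a * ∏ k ∈ s, (1 + δ k) + (∏ k ∈ s, (1 + δ k) - 1)|
          ≤ |δ a * ∏ k ∈ s, (1 + δ k)| + |∏ k ∈ s, (1 + δ k) - 1| := abs_add_le _ _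
        _ = |δ a| * |∏ k ∈ s, (1 + δ k)| + |∏ k ∈ s, (1 + δ k) - 1| := by rw [abs_mul]
        _ ≤ u * (1 + u) ^ s.card + ((1 + u) ^ s.card - 1) := by
            have := mul_le_mul hd hP (abs_nonneg _) hu
            linarith
        _ = (1 + u) * (1 + u) ^ s.card - 1 := by ring

/-- The factor met by summand `i ≤ n` deviates from `1` by at most `(1 + u)ⁿ − 1` (it has
`n + 1 − max(i,1) ≤ n` factors). [cite: BlanchardHighamMary2020, §2.1 eq. (2.2)] -/
theorem abs_recFactor_sub_one_le {u : K} (hu : 0 ≤ u) (δ : ℕ → K) (hδ : ∀ k, |δ k| ≤ u)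
    (i n : ℕ) : |recFactor δ i n - 1| ≤ (1 + u) ^ n - 1 := by
  unfold recFactor
  refine le_trans (abs_prod_one_add_sub_one_le hu δ hδ _) ?_
  have hcard : (Finset.Icc (max i 1) n).card ≤ n := by
    rw [Nat.card_Icc]
    have := le_max_right i 1
    omega
  have h1 : (1 : K) ≤ 1 + u := by linarith
  linarith [pow_le_pow_right₀ h1 hcard]

/-- EQ. (2.2) — RECURSIVE SUMMATION in backward form: the computed sum of `x 0, …, x n`
(`n` additions, errors `|δₖ| ≤ u`) is `Σ_{i ≤ n} xᵢ(1 + μᵢ)` with `|μᵢ| ≤ (1 + u)ⁿ − 1`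
(the source's `γ_{n−1}` for `n` summands is `γₙ` here, see `recSum_backward_gamma`).
[cite: BlanchardHighamMary2020, §2.1 eq. (2.2)] -/
theorem recSum_backward {u : K} (hu : 0 ≤ u) (x δ : ℕ → K) (hδ : ∀ k, |δ k| ≤ u) (n : ℕ) :
    ∃ μ : ℕ → K, (∀ i ∈ range (n + 1), |μ i| ≤ (1 + u) ^ n - 1) ∧
      recSum x δ n = ∑ i ∈ range (n + 1), x i * (1 + μ i) := by
  refine ⟨fun i => recFactor δ i n - 1, fun i _ => abs_recFactor_sub_one_le hu δ hδ i n, ?_⟩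
  rw [recSum_eq_sum_mul_recFactor]
  refine Finset.sum_congr rfl fun i _ => by ring

/-- EQ. (2.2), `γ` form: with `nu < 1` the backward error of recursive summation (`n` additions)
is at most `γₙ = nu/(1 − nu)`. [cite: BlanchardHighamMary2020, §2.1 eq. (2.2)] -/
theorem recSum_backward_gamma {u : K} (hu : 0 ≤ u) {n : ℕ} (hn : (n : K) * u < 1) (x δ : ℕ → K)
    (hδ : ∀ k, |δ k| ≤ u) : IsBackwardSum (range (n + 1)) x (recSum x δ n) (gamma u n) := by
  obtain ⟨μ, hμ, hs⟩ := recSum_backward hu x δ hδ n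
  exact ⟨μ, fun i hi => le_trans (hμ i hi) (one_add_pow_sub_one_le_gamma hu hn), hs⟩

/-! ## §2.2, eqs. (2.3)–(2.4): blocked (recursive) summation -/

/-- BLOCKED SUMMATION (§2.2): block `c` (`c ≤ m`) holds the summands `x c 0, …, x c b`; the local
sums (2.3) are computed by recursive summation with errors `δ c k`, and the local sums are summed by
recursive summation with errors `Δ k`. [cite: BlanchardHighamMary2020, §2.2 eqs. (2.3)–(2.4)] -/
def blockedRecSum (x δ : ℕ → ℕ → K) (Δ : ℕ → K) (b m : ℕ) : K :=
  recSum (fun c => recSum (x c) (δ c) b) Δ m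

/-- THEOREM 3.1 with `FastSum` = RECURSIVE SUMMATION of each block (`b` additions, errors
`|δ c k| ≤ u`) and ANY `AccurateSum` of backward constant `εa` on the `m + 1` local sums:
`T = Σ_c Σ_j x c j (1 + μ c j)` with `|μ c j| ≤ (1 + u)ᵇ(1 + εa) − 1`
(`= ε_f(b) + ε_a + ε_f(b)ε_a` with `ε_f(b) = (1 + u)ᵇ − 1`).
[cite: BlanchardHighamMary2020, §3.1 Theorem 3.1 with (2.2)] -/
theorem fabsum_recursive_backward {u : K} (hu : 0 ≤ u) (x δ : ℕ → ℕ → K)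
    (hδ : ∀ c k, |δ c k| ≤ u) (b m : ℕ) {εa T : K}
    (htot : ∃ μ : ℕ → K, (∀ c ∈ range (m + 1), |μ c| ≤ εa) ∧
      T = ∑ c ∈ range (m + 1), recSum (x c) (δ c) b * (1 + μ c)) :
    ∃ μ : ℕ → ℕ → K, (∀ c ∈ range (m + 1), ∀ j ∈ range (b + 1),
        |μ c j| ≤ (1 + u) ^ b * (1 + εa) - 1) ∧
      T = ∑ c ∈ range (m + 1), ∑ j ∈ range (b + 1), x c j * (1 + μ c j) := by
  have h := theorem31 (range (m + 1)) (fun _ => range (b + 1)) x (fun c => recSum (x c) (δ c) b)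
    (εf := (1 + u) ^ b - 1) (εa := εa) (T := T)
    (fun c _ => recSum_backward hu (x c) (δ c) (hδ c) b) htot
  obtain ⟨μ, hμ, hT⟩ := h
  refine ⟨μ, fun c hc j hj => ?_, hT⟩
  have := hμ c hc j hj
  rw [← one_add_mul_one_add_sub_one] at this
  simpa using this

/-- EQ. (2.4) — BLOCKED RECURSIVE SUMMATION in backward form: `m + 1` blocks of `b + 1` summands,
all errors `≤ u`: `ŝ = Σ_c Σ_j x c j (1 + μ c j)` with `|μ c j| ≤ (1 + u)^{b+m} − 1`
(the source's `γ_{b−1} + γ_{n/b−1} + γ_{b−1}γ_{n/b−1} ≤ γ_{b+n/b−2}`, in product form).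
[cite: BlanchardHighamMary2020, §2.2 eq. (2.4)] -/
theorem blockedRecSum_backward {u : K} (hu : 0 ≤ u) (x δ : ℕ → ℕ → K) (Δ : ℕ → K)
    (hδ : ∀ c k, |δ c k| ≤ u) (hΔ : ∀ k, |Δ k| ≤ u) (b m : ℕ) :
    ∃ μ : ℕ → ℕ → K, (∀ c ∈ range (m + 1), ∀ j ∈ range (b + 1),
        |μ c j| ≤ (1 + u) ^ (b + m) - 1) ∧
      blockedRecSum x δ Δ b m = ∑ c ∈ range (m + 1), ∑ j ∈ range (b + 1), x c j * (1 + μ c j) := by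
  obtain ⟨μ, hμ, hT⟩ := fabsum_recursive_backward hu x δ hδ b m (εa := (1 + u) ^ m - 1)
    (T := blockedRecSum x δ Δ b m) (recSum_backward hu _ Δ hΔ m)
  refine ⟨μ, fun c hc j hj => ?_, hT⟩
  have := hμ c hc j hj
  rwa [show (1 + u) ^ b * (1 + ((1 + u) ^ m - 1)) - 1 = (1 + u) ^ (b + m) - 1 by rw [pow_add]; ring]
    at this

/-- EQ. (2.4), `γ` form: with `(b + m)u < 1`, blocked recursive summation has backward error at
most `γ_{b+m}` (the source's `γ_{b+n/b−2}`; "the constant `b + n/b − 2` in the bound").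
[cite: BlanchardHighamMary2020, §2.2 eq. (2.4)] -/
theorem blockedRecSum_backward_gamma {u : K} (hu : 0 ≤ u) (x δ : ℕ → ℕ → K) (Δ : ℕ → K)
    (hδ : ∀ c k, |δ c k| ≤ u) (hΔ : ∀ k, |Δ k| ≤ u) {b m : ℕ} (hbm : ((b + m : ℕ) : K) * u < 1) :
    ∃ μ : ℕ → ℕ → K, (∀ c ∈ range (m + 1), ∀ j ∈ range (b + 1), |μ c j| ≤ gamma u (b + m)) ∧
      blockedRecSum x δ Δ b m = ∑ c ∈ range (m + 1), ∑ j ∈ range (b + 1), x c j * (1 + μ c j) := by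
  obtain ⟨μ, hμ, hT⟩ := blockedRecSum_backward hu x δ Δ hδ hΔ b m
  exact ⟨μ, fun c hc j hj => le_trans (hμ c hc j hj) (one_add_pow_sub_one_le_gamma hu hbm), hT⟩

/-! ## §3.1, eqs. (3.5)–(3.7): the three `AccurateSum` instances -/

/-- EQ. (3.5) — `AccurateSum` = RECURSIVE SUMMATION IN DOUBLED PRECISION (unit roundoff `u²`,
errors `|Δ k| ≤ u²`) WITH A FINAL ROUNDING back to the working precision (`|θ| ≤ u`), CONCRETELY:
the FABsum result `T = ŝ'(1 + θ)`, `ŝ' = ` the doubled-precision recursive sum of the `m + 1` local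
recursive sums (`b` additions each, errors `≤ u`), satisfies `T = Σ_c Σ_j x c j (1 + μ c j)` with
`|μ c j| ≤ (1 + u)ᵇ (1 + u²)ᵐ (1 + u) − 1` — first-order term `(b + 1)u`, i.e. the source's `bu`
for its block size `b` (`ε_a(n/b) = u + O(u²)`). [cite: BlanchardHighamMary2020, §3.1 eq. (3.5)] -/
theorem fabsum_doubled_backward {u : K} (hu : 0 ≤ u) (x δ : ℕ → ℕ → K) (Δ : ℕ → K) {θ : K}
    (hδ : ∀ c k, |δ c k| ≤ u) (hΔ : ∀ k, |Δ k| ≤ u ^ 2) (hθ : |θ| ≤ u) (b m : ℕ) :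
    ∃ μ : ℕ → ℕ → K, (∀ c ∈ range (m + 1), ∀ j ∈ range (b + 1),
        |μ c j| ≤ (1 + u) ^ b * ((1 + u ^ 2) ^ m * (1 + u)) - 1) ∧
      recSum (fun c => recSum (x c) (δ c) b) Δ m * (1 + θ)
        = ∑ c ∈ range (m + 1), ∑ j ∈ range (b + 1), x c j * (1 + μ c j) := by
  -- the accurate summation: doubled-precision recursive sum, then one rounding
  obtain ⟨ν, hν, hs⟩ := recSum_backward (sq_nonneg u) (fun c => recSum (x c) (δ c) b) Δ hΔ m
  have htot : ∃ μ : ℕ → K, (∀ c ∈ range (m + 1), |μ c| ≤ (1 + u ^ 2) ^ m * (1 + u) - 1) ∧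
      recSum (fun c => recSum (x c) (δ c) b) Δ m * (1 + θ)
        = ∑ c ∈ range (m + 1), recSum (x c) (δ c) b * (1 + μ c) := by
    refine ⟨fun c => (1 + ν c) * (1 + θ) - 1, fun c hc => ?_, ?_⟩
    · have := abs_one_add_mul_one_add_sub_one_le (hν c hc) hθ
      rwa [show (1 + ((1 + u ^ 2) ^ m - 1)) * (1 + u) - 1 = (1 + u ^ 2) ^ m * (1 + u) - 1 by ring]
        at this
    · rw [hs, Finset.sum_mul]
      refine Finset.sum_congr rfl fun c _ => by ring
  obtain ⟨μ, hμ, hT⟩ := fabsum_recursive_backward hu x δ hδ b m htot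
  refine ⟨μ, fun c hc j hj => ?_, hT⟩
  have := hμ c hc j hj
  rwa [show (1 + ((1 + u ^ 2) ^ m * (1 + u) - 1)) = (1 + u ^ 2) ^ m * (1 + u) by ring] at this

/-- EQ. (3.6) — `AccurateSum` = COMPENSATED SUMMATION, i.e. any summation of the local sums with a
backward constant `εa` (`εa = ε_a(n/b) = 2u + O(u²)` by (2.7) = [Goldberg 1991, Thm. 8] for
Algorithm 2.1 — a HYPOTHESIS here as in the source): `|μ| ≤ (1 + u)ᵇ(1 + εa) − 1`
`= ((1 + u)ᵇ − 1) + εa(1 + u)ᵇ` — first-order term `bu + 2u`, the source's `(b + 1)u` for its block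
size. [cite: BlanchardHighamMary2020, §3.1 eq. (3.6)] -/
theorem fabsum_compensated_backward {u : K} (hu : 0 ≤ u) (x δ : ℕ → ℕ → K)
    (hδ : ∀ c k, |δ c k| ≤ u) (b m : ℕ) {εa T : K}
    (hacc : IsBackwardSum (range (m + 1)) (fun c => recSum (x c) (δ c) b) T εa) :
    ∃ μ : ℕ → ℕ → K, (∀ c ∈ range (m + 1), ∀ j ∈ range (b + 1),
        |μ c j| ≤ ((1 + u) ^ b - 1) + εa * (1 + u) ^ b) ∧
      T = ∑ c ∈ range (m + 1), ∑ j ∈ range (b + 1), x c j * (1 + μ c j) := by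
  obtain ⟨μ, hμ, hT⟩ := fabsum_recursive_backward hu x δ hδ b m hacc
  refine ⟨μ, fun c hc j hj => ?_, hT⟩
  have := hμ c hc j hj
  rwa [show (1 + u) ^ b * (1 + εa) - 1 = ((1 + u) ^ b - 1) + εa * (1 + u) ^ b by ring] at this

/-- EQ. (3.7) — `AccurateSum` = PAIRWISE SUMMATION of the local sums, i.e. a summation of backward
constant `(1 + u)ᴸ − 1` with `L = ⌈log₂(n/b)⌉` its depth ((2.5) = [Higham2002ASNA §4.2]; a
HYPOTHESIS here as in the source): `|μ| ≤ (1 + u)^{b+L} − 1` — first order `(b + L)u`, the source's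
`(b − 1 + ⌈log₂(n/b)⌉)u` for its block size. [cite: BlanchardHighamMary2020, §3.1 eq. (3.7)] -/
theorem fabsum_pairwise_backward {u : K} (hu : 0 ≤ u) (x δ : ℕ → ℕ → K)
    (hδ : ∀ c k, |δ c k| ≤ u) (b m L : ℕ) {T : K}
    (hacc : IsBackwardSum (range (m + 1)) (fun c => recSum (x c) (δ c) b) T ((1 + u) ^ L - 1)) :
    ∃ μ : ℕ → ℕ → K, (∀ c ∈ range (m + 1), ∀ j ∈ range (b + 1), |μ c j| ≤ (1 + u) ^ (b + L) - 1) ∧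
      T = ∑ c ∈ range (m + 1), ∑ j ∈ range (b + 1), x c j * (1 + μ c j) := by
  obtain ⟨μ, hμ, hT⟩ := fabsum_recursive_backward hu x δ hδ b m hacc
  refine ⟨μ, fun c hc j hj => ?_, hT⟩
  have := hμ c hc j hj
  rwa [show (1 + u) ^ b * (1 + ((1 + u) ^ L - 1)) - 1 = (1 + u) ^ (b + L) - 1 by rw [pow_add]; ring]
    at this

/-- EQ. (3.7), `γ` form: `|μ| ≤ γ_{b+L}` when `(b + L)u < 1`.
[cite: BlanchardHighamMary2020, §3.1 eq. (3.7)] -/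
theorem fabsum_pairwise_backward_gamma {u : K} (hu : 0 ≤ u) (x δ : ℕ → ℕ → K)
    (hδ : ∀ c k, |δ c k| ≤ u) {b m L : ℕ} (hbL : ((b + L : ℕ) : K) * u < 1) {T : K}
    (hacc : IsBackwardSum (range (m + 1)) (fun c => recSum (x c) (δ c) b) T ((1 + u) ^ L - 1)) :
    ∃ μ : ℕ → ℕ → K, (∀ c ∈ range (m + 1), ∀ j ∈ range (b + 1), |μ c j| ≤ gamma u (b + L)) ∧
      T = ∑ c ∈ range (m + 1), ∑ j ∈ range (b + 1), x c j * (1 + μ c j) := by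
  obtain ⟨μ, hμ, hT⟩ := fabsum_pairwise_backward hu x δ hδ b m L hacc
  exact ⟨μ, fun c hc j hj => le_trans (hμ c hc j hj) (one_add_pow_sub_one_le_gamma hu hbL), hT⟩

/-! ## §3.1.2: the first-order readings, rigorously -/

/-- `(1 + u)ᵏ − 1 ≤ k · u · (1 + u)^{k−1}` for `u ≥ 0`: every product-form constant
`(1 + u)ᵏ − 1` above is its first-order term `ku` up to the factor `(1 + u)^{k−1} = 1 + O(u)` —
the rigorous content of the `ku + O(u²)` readings of §3.1.2 under the general model (2.1).
[cite: BlanchardHighamMary2020, §3.1.2] -/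
theorem one_add_pow_sub_one_le_mul_pow {u : K} (hu : 0 ≤ u) :
    ∀ k : ℕ, (1 + u) ^ k - 1 ≤ (k : K) * u * (1 + u) ^ (k - 1)
  | 0 => by simp
  | k + 1 => by
      have ih := one_add_pow_sub_one_le_mul_pow hu k
      have h1 : (1 : K) ≤ 1 + u := by linarith
      have hp : (1 + u) ^ (k - 1) ≤ (1 + u) ^ k := pow_le_pow_right₀ h1 (Nat.sub_le k 1)
      have hk : (0 : K) ≤ (k : K) * u := mul_nonneg (Nat.cast_nonneg k) hu
      rw [Nat.add_sub_cancel, pow_succ, Nat.cast_succ]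
      -- (1+u)^k (1+u) - 1 = ((1+u)^k - 1)(1+u) + u
      have hpk : (0 : K) ≤ (1 + u) ^ k - 1 := by
        have := one_le_pow₀ (n := k) h1
        linarith
      nlinarith [mul_le_mul_of_nonneg_right ih (by linarith : (0 : K) ≤ 1 + u),
        mul_le_mul_of_nonneg_left hp hk, one_le_pow₀ (n := k) h1]

/-- EQ. (2.4) read to first order: the backward error of blocked recursive summation is at most
`(b + m) · u · (1 + u)^{b+m−1}` ("`(b + n/b − 2)u + O(u²)`" for the source's block size).
[cite: BlanchardHighamMary2020, §2.2 eq. (2.4) and §3.1.2] -/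
theorem blockedRecSum_backward_firstOrder {u : K} (hu : 0 ≤ u) (x δ : ℕ → ℕ → K) (Δ : ℕ → K)
    (hδ : ∀ c k, |δ c k| ≤ u) (hΔ : ∀ k, |Δ k| ≤ u) (b m : ℕ) :
    ∃ μ : ℕ → ℕ → K, (∀ c ∈ range (m + 1), ∀ j ∈ range (b + 1),
        |μ c j| ≤ ((b + m : ℕ) : K) * u * (1 + u) ^ (b + m - 1)) ∧
      blockedRecSum x δ Δ b m = ∑ c ∈ range (m + 1), ∑ j ∈ range (b + 1), x c j * (1 + μ c j) := by
  obtain ⟨μ, hμ, hT⟩ := blockedRecSum_backward hu x δ Δ hδ hΔ b m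
  exact ⟨μ, fun c hc j hj => le_trans (hμ c hc j hj) (one_add_pow_sub_one_le_mul_pow hu _), hT⟩

/-! ## §3.1.1: accuracy versus stability — the backward error of a sum and its condition number -/

/-- The (normwise) BACKWARD ERROR of `ŝ` as an approximation to `s = Σ_{i∈s} xᵢ`:
`η(ŝ) = |ŝ − s| / Σ |xᵢ|` — the special case of the Oettli–Prager theorem [Higham2002ASNA,
Thm. 7.3] for sums. [cite: BlanchardHighamMary2020, §3.1.1] -/
def backwardError {ι : Type*} (s : Finset ι) (x : ι → K) (ŝ : K) : K :=
  |ŝ - ∑ i ∈ s, x i| / ∑ i ∈ s, |x i|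

/-- `η(ŝ) ≥ 0`. [cite: BlanchardHighamMary2020, §3.1.1] -/
theorem backwardError_nonneg {ι : Type*} (s : Finset ι) (x : ι → K) (ŝ : K) :
    0 ≤ backwardError s x ŝ :=
  div_nonneg (abs_nonneg _) (Finset.sum_nonneg fun _ _ => abs_nonneg _)

/-- `η(ŝ)` is a LOWER bound for every backward error: if `ŝ = Σ xᵢ(1 + μᵢ)` with `|μᵢ| ≤ ε` then
`η(ŝ) ≤ ε` (data not all zero). [cite: BlanchardHighamMary2020, §3.1.1] -/
theorem backwardError_le_of_isBackwardSum {ι : Type*} {s : Finset ι} {x : ι → K} {ŝ ε : K}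
    (h : IsBackwardSum s x ŝ ε) (hx : 0 < ∑ i ∈ s, |x i|) : backwardError s x ŝ ≤ ε := by
  unfold backwardError
  rw [div_le_iff₀ hx]
  exact abs_sub_sum_le_of_isBackwardSum h

/-- `η(ŝ)` is ATTAINED: `ŝ = Σ xᵢ(1 + μᵢ)` with `μᵢ = sign(xᵢ)·(ŝ − s)/Σ|xⱼ|`, `|μᵢ| ≤ η(ŝ)` — so
`η(ŝ)` IS the backward error of `ŝ` (Oettli–Prager for sums). Data not all zero.
[cite: BlanchardHighamMary2020, §3.1.1] -/
theorem isBackwardSum_backwardError {ι : Type*} (s : Finset ι) (x : ι → K) (ŝ : K)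
    (hx : 0 < ∑ i ∈ s, |x i|) : IsBackwardSum s x ŝ (backwardError s x ŝ) := by
  set A := ∑ i ∈ s, |x i| with hA
  set e := ŝ - ∑ i ∈ s, x i with he
  -- the sign pattern of the data: σᵢ xᵢ = |xᵢ|, |σᵢ| = 1
  let σ : ι → K := fun i => if 0 ≤ x i then 1 else -1
  have hσx : ∀ i, σ i * x i = |x i| := by
    intro i
    by_cases h : 0 ≤ x i
    · simp [σ, h, abs_of_nonneg h]
    · simp [σ, h, abs_of_neg (lt_of_not_ge h)]
  have hσ1 : ∀ i, |σ i| = 1 := by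
    intro i
    by_cases h : 0 ≤ x i <;> simp [σ, h]
  refine ⟨fun i => σ i * e / A, fun i _ => ?_, ?_⟩
  · rw [backwardError, ← hA, ← he, abs_div, abs_mul, hσ1, one_mul, abs_of_pos hx]
  · have hsum : ∑ i ∈ s, x i * (1 + σ i * e / A) = (∑ i ∈ s, x i) + e := by
      have h1 : ∀ i ∈ s, x i * (1 + σ i * e / A) = x i + |x i| * (e / A) := by
        intro i _
        rw [← hσx i]
        ring
      rw [Finset.sum_congr rfl h1, Finset.sum_add_distrib, ← Finset.sum_mul, ← hA]
      congr 1
      field_simp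
    rw [hsum, he]
    ring

/-- The CONDITION NUMBER of the sum `s = Σ xᵢ`: `cond = Σ |xᵢ| / |s|` — "a factor that depends on
the data but not the algorithm". [cite: BlanchardHighamMary2020, §3.1.1] -/
def condSum {ι : Type*} (s : Finset ι) (x : ι → K) : K := (∑ i ∈ s, |x i|) / |∑ i ∈ s, x i|

/-- FORWARD ≤ COND × BACKWARD: the relative forward error of a computed sum of backward error `ε` is
at most `cond · ε` (`s ≠ 0`). [cite: BlanchardHighamMary2020, §3.1.1] -/
theorem abs_sub_sum_div_le {ι : Type*} {s : Finset ι} {x : ι → K} {ŝ ε : K}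
    (h : IsBackwardSum s x ŝ ε) (hs : ∑ i ∈ s, x i ≠ 0) :
    |ŝ - ∑ i ∈ s, x i| / |∑ i ∈ s, x i| ≤ condSum s x * ε := by
  have hpos : 0 < |∑ i ∈ s, x i| := abs_pos.mpr hs
  have heq : condSum s x * ε = (ε * ∑ i ∈ s, |x i|) / |∑ i ∈ s, x i| := by
    rw [condSum]
    ring
  rw [heq, div_le_div_iff_of_pos_right hpos]
  exact abs_sub_sum_le_of_isBackwardSum h

/-- The relative forward error equals `cond · η(ŝ)` exactly (`s ≠ 0`, whence the data are not all
zero): accuracy and stability differ precisely by the condition number.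
[cite: BlanchardHighamMary2020, §3.1.1] -/
theorem abs_sub_sum_div_eq_condSum_mul_backwardError {ι : Type*} (s : Finset ι) (x : ι → K)
    (ŝ : K) (hs : ∑ i ∈ s, x i ≠ 0) :
    |ŝ - ∑ i ∈ s, x i| / |∑ i ∈ s, x i| = condSum s x * backwardError s x ŝ := by
  have hA : 0 < ∑ i ∈ s, |x i| :=
    lt_of_lt_of_le (abs_pos.mpr hs) (Finset.abs_sum_le_sum_abs _ _)
  rw [condSum, backwardError]
  field_simp

/-! ## §4: FABsum inside numerical linear algebra kernels -/

/-- THEOREM 4.1 (inner product via FABsum, Algorithm 4.1): the products `z c j = x c j · y c j (1 + ν c j)`,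
`|ν c j| ≤ u` (one rounding error each), summed by FABsum — local sums of the `z` backward-exact to
`εf`, their combination backward-exact to `εa` — give `T = Σ_c Σ_j x c j y c j (1 + μ c j)` with
`|μ c j| ≤ (1 + u)(1 + ε(n,b)) − 1 = u + ε(n,b)(1 + u)`, `ε(n,b) = εf + εa + εf εa`.
[cite: BlanchardHighamMary2020, §4 Theorem 4.1] -/
theorem theorem41 {β κ : Type*} (t : Finset β) (sk : β → Finset κ) (x y ν : β → κ → K)
    (ŝ : β → K) {u εf εa T : K} (hν : ∀ c ∈ t, ∀ j ∈ sk c, |ν c j| ≤ u)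
    (hloc : ∀ c ∈ t, ∃ μ : κ → K, (∀ j ∈ sk c, |μ j| ≤ εf) ∧
      ŝ c = ∑ j ∈ sk c, (x c j * y c j * (1 + ν c j)) * (1 + μ j))
    (htot : ∃ μ : β → K, (∀ c ∈ t, |μ c| ≤ εa) ∧ T = ∑ c ∈ t, ŝ c * (1 + μ c)) :
    ∃ μ : β → κ → K, (∀ c ∈ t, ∀ j ∈ sk c,
        |μ c j| ≤ (1 + u) * (1 + (εf + εa + εf * εa)) - 1) ∧
      T = ∑ c ∈ t, ∑ j ∈ sk c, x c j * y c j * (1 + μ c j) := by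
  obtain ⟨μ, hμ, hT⟩ := theorem31 t sk (fun c j => x c j * y c j * (1 + ν c j)) ŝ hloc htot
  refine ⟨fun c j => (1 + ν c j) * (1 + μ c j) - 1, fun c hc j hj => ?_, ?_⟩
  · exact abs_one_add_mul_one_add_sub_one_le (hν c hc j hj) (hμ c hc j hj)
  · rw [hT]
    refine Finset.sum_congr rfl fun c _ => Finset.sum_congr rfl fun j _ => by ring

/-- THEOREM 4.2 (matrix–vector product `y = Ax` by inner products via Algorithm 4.1): if every
component is an inner product of backward constant `ε` — `ŷ i = Σ_j a i j x j (1 + μ i j)`,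
`|μ i j| ≤ ε` — then `ŷ = (A + ΔA)x` with `|ΔA| ≤ ε|A|` componentwise.
[cite: BlanchardHighamMary2020, §4 Theorem 4.2] -/
theorem theorem42_mulVec {ι κ : Type*} (rows : Finset ι) (cols : Finset κ) (a : ι → κ → K)
    (x : κ → K) (ŷ : ι → K) {ε : K}
    (hy : ∀ i ∈ rows, ∃ μ : κ → K, (∀ j ∈ cols, |μ j| ≤ ε) ∧
      ŷ i = ∑ j ∈ cols, a i j * x j * (1 + μ j)) :
    ∃ ΔA : ι → κ → K, (∀ i ∈ rows, ∀ j ∈ cols, |ΔA i j| ≤ ε * |a i j|) ∧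
      ∀ i ∈ rows, ŷ i = ∑ j ∈ cols, (a i j + ΔA i j) * x j := by
  classical
  have hch : ∀ i, ∃ μ : κ → K, i ∈ rows → (∀ j ∈ cols, |μ j| ≤ ε) ∧
      ŷ i = ∑ j ∈ cols, a i j * x j * (1 + μ j) := by
    intro i
    by_cases hi : i ∈ rows
    · obtain ⟨μ, hμ⟩ := hy i hi
      exact ⟨μ, fun _ => hμ⟩
    · exact ⟨fun _ => 0, fun h => absurd h hi⟩
  choose μ hμ using hch
  refine ⟨fun i j => a i j * μ i j, fun i hi j hj => ?_, fun i hi => ?_⟩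
  · rw [abs_mul, mul_comm]
    exact mul_le_mul_of_nonneg_right ((hμ i hi).1 j hj) (abs_nonneg _)
  · rw [(hμ i hi).2]
    refine Finset.sum_congr rfl fun j _ => by ring

/-- THEOREM 4.2 (matrix–matrix product `C = AB` by inner products via Algorithm 4.1): if every entry
is an inner product of backward constant `ε` — `ĉ i k = Σ_j a i j b j k (1 + μ i k j)`,
`|μ i k j| ≤ ε` — then `|Ĉ − AB| ≤ ε |A||B|` componentwise.
[cite: BlanchardHighamMary2020, §4 Theorem 4.2] -/
theorem theorem42_mul {ι κ ρ : Type*} (rows : Finset ι) (inner : Finset κ) (cols : Finset ρ)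
    (a : ι → κ → K) (b : κ → ρ → K) (ĉ : ι → ρ → K) {ε : K}
    (hc : ∀ i ∈ rows, ∀ k ∈ cols, ∃ μ : κ → K, (∀ j ∈ inner, |μ j| ≤ ε) ∧
      ĉ i k = ∑ j ∈ inner, a i j * b j k * (1 + μ j)) :
    ∀ i ∈ rows, ∀ k ∈ cols,
      |ĉ i k - ∑ j ∈ inner, a i j * b j k| ≤ ε * ∑ j ∈ inner, |a i j| * |b j k| := by
  intro i hi k hk
  obtain ⟨μ, hμ, hcik⟩ := hc i hi k hk
  have h := abs_sub_sum_le_of_isBackwardSum (s := inner) (x := fun j => a i j * b j k)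
    (ŝ := ĉ i k) (ε := ε) ⟨μ, hμ, hcik⟩
  simpa only [abs_mul] using h

end Literature.ComputerArithmetic.BlanchardHighamMary2020
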